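import Literature.AnabelianGeometry.EtaleTheta.ThetaCovers
import Literature.AnabelianGeometry.EtaleTheta.Discharge.Sec2ClassTwoCommutators
import HarnessLib

/-!
# [EtTh] §2, Def 2.1 / Rmk 2.1.1 / Prop 2.2 (i): the inversion acts by `+1` on `Δ̄_Θ` BECAUSE it acts
# by `−1` on `Δ̄^ell_X` (proof-only companion of `ThetaCovers.lean` / `ThetaCoversAxioms.lean`)

Mochizuki, *The Étale Theta Function …* [EtTh], Publ. RIMS 45 (2009), §2 (bib key `MochizukiEtTh2009`;
locators = PDF pages of the PRIMS text): Def 2.1 p.35 "`Δ_Θ` for the image of `∧² Δ^ab_X`", "`Δ̄_Θ`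
central", Rmk 2.1.1 p.36 "`ι` acts on `Q` by multiplication by `−1`", Prop 2.2 (i) p.37 "eigenvalues `−1`
and `1`, respectively".

Cell abc-iut, layer L2 (GAP-LEDGER row G-L2t10-4, the clause «the second FOLLOWS from the first by the
commutator pairing `Δ̄_Θ = Im ∧² Δ̄^ell` — derivation not yet typed»).  Over abc-iut-L2-t2's interface
`ThetaCovers.CoverData` (NOT the supplemented `CoverDataAx`, whose field `inv_theta` is the statement
proved here) we PROVE, by the class-two commutator calculus of `Discharge/Sec2ClassTwoCommutators.lean`:

* `conj_commutator_mem_barKer_of_inv_ell` (using that `Δ̄_X` is of class two — interface fields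
  `ell_rank_two`, `barTheta_central`, as in abc-iut-L2-d3's `Discharge/Sec2AutKPairing.lean` for
  `CoverDataAx`) — if `c ∈ Π_C` acts by `−1` on `Δ̄^ell_X`
  (`∀ d ∈ Δ_X, c d c⁻¹ d ∈ Δ̄_Θ-preimage`), then `c` FIXES every commutator `[d₁, d₂]` (`dᵢ ∈ Δ_X`)
  modulo `Ker(Δ_X ↠ Δ̄_X)` («`(−1)·(−1) = +1` on `∧²`»);
* `inv_theta_of_inv_ell` — hence, under the printed definition of `Δ_Θ` as the commutator image
  (`hΘ : Δ̄_Θ-preimage ≤ [Δ_X, Δ_X] ⊔ Ker`, the `≤` half of the hypothesis `hΘ` of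
  `Discharge/Sec2AutKPairing.lean` = GAP-LEDGER G-L2d3-1), `c` acts by `+1` on `Δ̄_Θ`: the field
  `CoverDataAx.inv_theta` is a CONSEQUENCE of `CoverDataAx.inv_ell` + `hΘ` (`inv_theta_of_inv_ell'`
  has exactly the binder shapes of those two fields).

The MODEL-level companion (no `hΘ`: at abc-iut-L2-t10's `ThetaSetting.PiCData` the `Δ̄_Θ`-preimage IS the
closure of the commutators by definition) is abc-iut-L6-d6's `Discharge/Sec2Prop22InvThetaOfInvEll.lean`
(L2-lead row R23); the present file is the interface-generic form, usable by ANY constructor of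
`CoverDataAx` from a `CoverData` satisfying the printed definition of `Δ_Θ`.

Pure group theory; no definition, no named fact; nothing asserts that a `CoverData` exists; nothing here
bears on [IUTchIII] Cor. 3.12.
-/

namespace Literature.AnabelianGeometry.EtaleTheta

namespace ThetaCovers

namespace CoverData

open scoped commutatorElement

universe u

variable {l : ℕ} (X : CoverData.{u} l)

/-- **`(−1)·(−1) = +1` on `∧² Δ̄^ell_X`.**  If `c ∈ Π_C` acts by `−1` on `Δ̄^ell_X = Δ_X/Δ̄_Θ-preimage`
(`c d c⁻¹ ≡ d⁻¹`), then `c` fixes every commutator `[d₁, d₂]`, `dᵢ ∈ Δ_X`, modulo `Ker(Δ_X ↠ Δ̄_X)`: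
`c [d₁,d₂] c⁻¹ = [t₁ d₁⁻¹, t₂ d₂⁻¹] ≡ [d₁⁻¹, d₂⁻¹] ≡ [d₁, d₂]` with `tᵢ ∈ Δ̄_Θ`-preimage central
(class-two calculus, `ClassTwo.mk_commutator_*`). [cite: MochizukiEtTh2009, Prop 2.2(i) p.37] -/
theorem conj_commutator_mem_barKer_of_inv_ell {c : X.PiC}
    (hell : ∀ d ∈ X.DeltaX, c * d * c⁻¹ * d ∈ X.barTheta) {d₁ d₂ : X.PiC} (h₁ : d₁ ∈ X.DeltaX)
    (h₂ : d₂ ∈ X.DeltaX) : c * ⁅d₁, d₂⁆ * c⁻¹ * ⁅d₁, d₂⁆⁻¹ ∈ X.barKer := by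
  haveI := X.barKer_normal
  -- `[Δ_X, Δ_X] ⊆ Δ̄_Θ`-preimage: `Δ_X/Δ̄_Θ-preimage ≅ (ℤ/lℤ)²` is abelian (field `ell_rank_two`); this and
  -- the next `have` are abc-iut-L2-d3's `CoverDataAx.commutator_deltaX_le_barTheta` /
  -- `commutator_deltaX_barTheta_le_barKer` (Discharge/Sec2AutKPairing.lean), whose proofs use only
  -- `CoverData` fields and are repeated here because we are NOT given a `CoverDataAx`.
  have hAA : ⁅X.DeltaX, X.DeltaX⁆ ≤ X.barTheta := by
    haveI := X.barTheta_normal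
    haveI : (X.barTheta.subgroupOf X.DeltaX).Normal := X.barTheta_normal.subgroupOf _
    obtain ⟨e⟩ := X.ell_rank_two
    rw [Subgroup.commutator_le]
    intro x hx y hy
    let ψ : X.DeltaX →* Multiplicative (ZMod l × ZMod l) :=
      e.toMonoidHom.comp (QuotientGroup.mk' (X.barTheta.subgroupOf X.DeltaX))
    have hψ : ∀ d : X.DeltaX, ψ d = 1 ↔ (d : X.PiC) ∈ X.barTheta := by
      intro d
      change e (QuotientGroup.mk d) = 1 ↔ _
      rw [← map_one e, e.injective.eq_iff, QuotientGroup.eq_one_iff, Subgroup.mem_subgroupOf]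
    have h1 : ψ ⁅(⟨x, hx⟩ : X.DeltaX), ⟨y, hy⟩⁆ = 1 := by
      rw [map_commutatorElement, commutatorElement_eq_one_iff_mul_comm, mul_comm]
    have h2 := (hψ _).mp h1
    simpa [commutatorElement_def] using h2
  have hK₂A : X.barTheta ≤ X.DeltaX := X.barTheta_le
  -- `[Δ_X, Δ̄_Θ-preimage] ⊆ Ker`: "`Δ̄_Θ` is central in `Δ̄_X`" (field `barTheta_central`)
  have hAK : ⁅X.DeltaX, X.barTheta⁆ ≤ X.barKer := by
    rw [Subgroup.commutator_comm, Subgroup.commutator_le]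
    intro t ht d hd
    rw [commutatorElement_def]
    exact X.barTheta_central t ht d hd
  -- the central corrections `tᵢ := c dᵢ c⁻¹ dᵢ ∈ Δ̄_Θ`-preimage, so that `c dᵢ c⁻¹ = tᵢ dᵢ⁻¹`
  set t₁ : X.PiC := c * d₁ * c⁻¹ * d₁ with ht₁def
  set t₂ : X.PiC := c * d₂ * c⁻¹ * d₂ with ht₂def
  have ht₁ : t₁ ∈ X.barTheta := hell d₁ h₁
  have ht₂ : t₂ ∈ X.barTheta := hell d₂ h₂
  have hc₁ : c * d₁ * c⁻¹ = t₁ * d₁⁻¹ := by rw [ht₁def]; group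
  have hc₂ : c * d₂ * c⁻¹ = t₂ * d₂⁻¹ := by rw [ht₂def]; group
  -- conjugation is a homomorphism: `c [d₁, d₂] c⁻¹ = [c d₁ c⁻¹, c d₂ c⁻¹] = [t₁ d₁⁻¹, t₂ d₂⁻¹]`
  have hconj : c * ⁅d₁, d₂⁆ * c⁻¹ = ⁅t₁ * d₁⁻¹, t₂ * d₂⁻¹⁆ := by
    rw [← hc₁, ← hc₂]; simp only [commutatorElement_def]; group
  -- work modulo `Ker`: it suffices that the images in `Π_C / Ker` agree
  rw [← QuotientGroup.eq_one_iff, QuotientGroup.mk_mul, QuotientGroup.mk_inv, mul_inv_eq_one, hconj]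
  have hd₁' : d₁⁻¹ ∈ X.DeltaX := inv_mem h₁
  have hd₂' : d₂⁻¹ ∈ X.DeltaX := inv_mem h₂
  have ht₁A : t₁ ∈ X.DeltaX := hK₂A ht₁
  have ht₂A : t₂ ∈ X.DeltaX := hK₂A ht₂
  -- a commutator with a central (`∈ Δ̄_Θ`-preimage) entry dies modulo `Ker`
  have hvanL : ∀ {t y : X.PiC}, t ∈ X.barTheta → y ∈ X.DeltaX →
      ((⁅t, y⁆ : X.PiC) : X.PiC ⧸ X.barKer) = 1 := by
    intro t y ht hy
    rw [QuotientGroup.eq_one_iff]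
    rw [Subgroup.commutator_comm] at hAK
    exact hAK (Subgroup.commutator_mem_commutator ht hy)
  have hvanR : ∀ {y t : X.PiC}, y ∈ X.DeltaX → t ∈ X.barTheta →
      ((⁅y, t⁆ : X.PiC) : X.PiC ⧸ X.barKer) = 1 := by
    intro y t hy ht
    rw [QuotientGroup.eq_one_iff]
    exact hAK (Subgroup.commutator_mem_commutator hy ht)
  calc (((⁅t₁ * d₁⁻¹, t₂ * d₂⁻¹⁆ : X.PiC)) : X.PiC ⧸ X.barKer)
      = ((⁅t₁, t₂ * d₂⁻¹⁆ : X.PiC) : X.PiC ⧸ X.barKer) * ((⁅d₁⁻¹, t₂ * d₂⁻¹⁆ : X.PiC) : _) :=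
        ClassTwo.mk_commutator_mul_left X.DeltaX X.barTheta X.barKer hAA hK₂A hAK ht₁A hd₁'
          (mul_mem ht₂A hd₂')
    _ = ((⁅d₁⁻¹, t₂ * d₂⁻¹⁆ : X.PiC) : X.PiC ⧸ X.barKer) := by
        rw [hvanL ht₁ (mul_mem ht₂A hd₂'), one_mul]
    _ = ((⁅d₁⁻¹, t₂⁆ : X.PiC) : X.PiC ⧸ X.barKer) * ((⁅d₁⁻¹, d₂⁻¹⁆ : X.PiC) : _) :=
        ClassTwo.mk_commutator_mul_right X.DeltaX X.barTheta X.barKer hAA hAK hd₁' ht₂A hd₂'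
    _ = ((⁅d₁⁻¹, d₂⁻¹⁆ : X.PiC) : X.PiC ⧸ X.barKer) := by rw [hvanR hd₁' ht₂, one_mul]
    _ = (((⁅d₁, d₂⁻¹⁆ : X.PiC) : X.PiC ⧸ X.barKer))⁻¹ := by
        have h := ClassTwo.mk_commutator_zpow_left X.DeltaX X.barTheta X.barKer hAA hK₂A hAK h₁ hd₂' (-1)
        simpa using h
    _ = ((⁅d₁, d₂⁆ : X.PiC) : X.PiC ⧸ X.barKer) := by
        rw [ClassTwo.mk_commutator_inv_right X.DeltaX X.barTheta X.barKer hAA hAK h₁ h₂, inv_inv]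

/-- **`CoverDataAx.inv_theta` from `CoverDataAx.inv_ell` and the commutator pairing.**  If
`Δ̄_Θ`-preimage `⊆ [Δ_X, Δ_X] · Ker` (the printed DEFINITION "`Δ_Θ := Im(∧² Δ^ab_X)`", p.35 — the `≤`
half of `hΘ` of `Discharge/Sec2AutKPairing.lean`) and `c ∈ Π_C` acts by `−1` on `Δ̄^ell_X`, then `c`
acts by `+1` on `Δ̄_Θ`: `c t c⁻¹ t⁻¹ ∈ Ker` for every `t` in the `Δ̄_Θ`-preimage ("eigenvalues `−1` and
`1`, respectively"). [cite: MochizukiEtTh2009, Prop 2.2(i) p.37] -/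
theorem inv_theta_of_inv_ell (hΘ : X.barTheta ≤ ⁅X.DeltaX, X.DeltaX⁆ ⊔ X.barKer) {c : X.PiC}
    (hell : ∀ d ∈ X.DeltaX, c * d * c⁻¹ * d ∈ X.barTheta) :
    ∀ t ∈ X.barTheta, c * t * c⁻¹ * t⁻¹ ∈ X.barKer := by
  haveI := X.barKer_normal
  -- the elements fixed by `c` modulo `Ker` form a subgroup `F` (preimage of a centraliser)
  let F : Subgroup X.PiC :=
    (Subgroup.centralizer ({(c : X.PiC ⧸ X.barKer)} : Set (X.PiC ⧸ X.barKer))).comap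
      (QuotientGroup.mk' X.barKer)
  have memF : ∀ g : X.PiC, g ∈ F ↔ c * g * c⁻¹ * g⁻¹ ∈ X.barKer := by
    intro g
    have hF : g ∈ F ↔ (c : X.PiC ⧸ X.barKer) * g = g * c := by
      simp only [F, Subgroup.mem_comap, QuotientGroup.mk'_apply, Subgroup.mem_centralizer_iff,
        Set.mem_singleton_iff, forall_eq]
    have hK : c * g * c⁻¹ * g⁻¹ ∈ X.barKer ↔ (c : X.PiC ⧸ X.barKer) * g = g * c := by
      rw [← QuotientGroup.eq_one_iff, ← commutatorElement_eq_one_iff_mul_comm, commutatorElement_def]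
      simp only [QuotientGroup.mk_mul, QuotientGroup.mk_inv]
    rw [hF, hK]
  suffices hTF : X.barTheta ≤ F by
    intro t ht
    exact (memF t).mp (hTF ht)
  refine hΘ.trans (sup_le ?_ fun k hk => ?_)
  · rw [Subgroup.commutator_le]
    intro d₁ h₁ d₂ h₂
    exact (memF _).mpr (X.conj_commutator_mem_barKer_of_inv_ell hell h₁ h₂)
  · exact (memF k).mpr (mul_mem (X.barKer_normal.conj_mem k hk c) (inv_mem hk))

/-- The same with the literal binder shapes of the two `CoverDataAx` fields: **`inv_ell` + `hΘ` ⟹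
`inv_theta`** (so a constructor of `CoverDataAx` over data satisfying the printed definition of `Δ_Θ`
need only establish the `Δ̄^ell_X`-clause). [cite: MochizukiEtTh2009, Prop 2.2(i) p.37] -/
theorem inv_theta_of_inv_ell' (hΘ : ⁅X.DeltaX, X.DeltaX⁆ ⊔ X.barKer = X.barTheta)
    (hell : ∀ c ∈ X.aug.ker, c ∉ X.PiX → ∀ d ∈ X.PiX ⊓ X.aug.ker, c * d * c⁻¹ * d ∈ X.barTheta) :
    ∀ c ∈ X.aug.ker, c ∉ X.PiX → ∀ t ∈ X.barTheta, c * t * c⁻¹ * t⁻¹ ∈ X.barKer :=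
  fun c hc hcX => X.inv_theta_of_inv_ell hΘ.ge (hell c hc hcX)

end CoverData

end ThetaCovers

end Literature.AnabelianGeometry.EtaleTheta
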